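import Summits.ResolutionOfSingularities.ResolutionOfSingularities.Theorems.FrobeniusLadderFRationalResolutionFamilyLogRegularNhd
import Summits.ResolutionOfSingularities.ResolutionOfSingularities.Theorems.FrobeniusLadderFRationalResolutionStabilizerAdaptedGenerators
import Summits.ResolutionOfSingularities.ResolutionOfSingularities.Theorems.FrobeniusLadderFRationalResolutionCoarsening
import HarnessLib

/-!
# Crux `FrobeniusLadder.FRationalResolution` (stmt-ResolutionOfSingularities-15317), line `redirect`,
# stub `stub_diagonalizableQuotientResolution` — at an ARBITRARY prime `𝔔` of a regular graded `S`:
# the intermediate ring `T = S^{(B)}` carries a `D(B)`-HOMOGENEOUS monomial chart which is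
# Kato-log-regular on a whole neighbourhood of `𝔔 ∩ T` (brick W2' of memo MEMO-15317-leafhand2-g4 §2bis)

`S` regular of finite type over a field `k`, graded by a torsion abelian group `A`; `𝔔` ANY prime,
`B = {a : S_a ⊄ 𝔔}` its unit-degree subgroup (`…StabilizerSubgroup`). Coarsen the grading along
`A → A/B` (`…Coarsening.exists_coarsening_fixed`): `𝔔` is fixed for it and the degree-zero ring is
`T = ⊕_{b∈B} S_b`. Take a stabilizer-ADAPTED regular system of parameters at `𝔔`
(`…StabilizerAdaptedGenerators`): the members of degree `∉ B` are `A`-HOMOGENEOUS, `x₁,…,x_n`, the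
others lie in `T`. Then monomial generation `g • S ⊆ T[x]` holds for the sub-family `x` alone
(`…FixedPointMonomialNhd` for the coarsened grading, the remaining parameters being scalars), so
`…FamilyLogRegularNhd.exists_nhd_isLogRegularAt_of_family` applies: the chart
`φ : P'' = {m ∈ ℤⁿ_{≥0} : Σ mᵢ āᵢ = 0 ∈ A/B} → T`, `φ(m) = x^m`, is Kato-log-regular at every prime of
a basic open neighbourhood `D(g') ∋ 𝔔 ∩ T` of `Spec T`. Its chart elements `x^m` are
`A`-homogeneous of degrees in `B` — the `D(B)`-STABLE log structure on `T` needed for the descent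
`T → S₀ = T^{D(B)}` (bricks W3'–W4' of the memo, not here).

* `mem_gradeZero_of_forall_decompose_eq_zero` — an element with no components outside `B` lies in `T`;
* **`exists_coarse_chart_nhd_isLogRegularAt`** — the statement above (existential package: the
  coarsened grading, the homogeneous family, the chart, the neighbourhood).

Honest label: brick of the wild non-fixed route (no stub closed). No definitions, no named facts,
no sorry. [cite: Kato1994, Def. (2.1), Prop. (7.1)] [folklore; cite: SGA3, Exp. VIII §4–5]
-/

noncomputable section

-- single-problem summit: the doubled namespace component is forced
set_option linter.dupNamespace false

open DirectSum IsLocalRing Literature.AlgebraicGeometry.Resolution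
open Literature.AlgebraicGeometry.Resolution.DiagonalizableQuotient

namespace Summit.ResolutionOfSingularities.ResolutionOfSingularities.Theorems.FRationalResolution.CoarseChartLogRegularNhd

universe u w

variable {k : Type u} [Field k] {A : Type w} [DecidableEq A] [AddCommGroup A] {S : Type u}
  [CommRing S] [Algebra k S] (𝒮 : A → Submodule k S) [GradedAlgebra 𝒮]

/-- An element all of whose homogeneous components of degree `∉ B` vanish lies in the degree-zero
piece `⊕_{b ∈ B} S_b` of the grading coarsened along `A → A/B`. [folklore] -/
theorem mem_gradeZero_of_forall_decompose_eq_zero (B : AddSubgroup A)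
    (𝒮' : A ⧸ B → Submodule k S) (hle : ∀ a, 𝒮 a ≤ 𝒮' (a : A ⧸ B)) {y : S}
    (hy : ∀ a : A, a ∉ B → (decompose 𝒮 y a : S) = 0) : y ∈ 𝒮' 0 := by
  classical
  rw [← sum_support_decompose 𝒮 y]
  refine Submodule.sum_mem _ fun a _ => ?_
  by_cases haB : a ∈ B
  · have h0 : ((a : A ⧸ B)) = 0 := (QuotientAddGroup.eq_zero_iff a).mpr haB
    exact h0 ▸ hle a (decompose 𝒮 y a).2
  · rw [hy a haB]
    exact Submodule.zero_mem _

/-- **A `D(B)`-homogeneous log-regular chart of `T = S^{(B)}` around any point.** `S` regular of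
finite type over a field, graded by a torsion group `A`; `𝔔` a prime with unit-degree subgroup `B`.
There are: the coarsened grading `𝒮'` by `A/B` (`S_a ⊆ S'_{[a]}`), `A`-HOMOGENEOUS `x₁,…,x_n ∈ 𝔔`
of degrees `aᵢ ∉ B`, part of a regular system of parameters of `S_𝔔`, the monomial chart
`φ(m) = x^m` on `P'' = {m ≥ 0 : Σ mᵢ[aᵢ] = 0 ∈ A/B}` with values in `T = S'_0`, and `g' ∈ T ∖ 𝔔`
such that `LogChart.IsLogRegularAt P'' φ 𝔮` for every prime `𝔮 ∌ g'` of `T`.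
[cite: Kato1994, Def. (2.1), Prop. (7.1)] [folklore; cite: SGA3, Exp. VIII §4–5] -/
theorem exists_coarse_chart_nhd_isLogRegularAt [IsRegularRing S] [Algebra.FiniteType k S]
    (hA : AddMonoid.IsTorsion A) (𝔔 : Ideal S) [𝔔.IsPrime] (B : AddSubgroup A)
    (hB : ∀ a : A, a ∈ B ↔ ∃ s ∈ 𝒮 a, s ∉ 𝔔) [DecidableEq (A ⧸ B)] :
    ∃ (𝒮' : A ⧸ B → Submodule k S) (_ : GradedAlgebra 𝒮'),
      (∀ c, 𝒮' c = ⨆ a ∈ {a : A | (a : A ⧸ B) = c}, 𝒮 a) ∧ (∀ a, 𝒮 a ≤ 𝒮' (a : A ⧸ B)) ∧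
      (∀ c : A ⧸ B, c ≠ 0 → ∀ s ∈ 𝒮' c, s ∈ 𝔔) ∧
      ∃ (n : ℕ) (x : Fin n → S) (a : Fin n → A),
        (∀ i, x i ∈ 𝔔 ∧ x i ∈ 𝒮 (a i) ∧ a i ∉ B) ∧
        IsRsopPart (fun i => algebraMap S (Localization.AtPrime 𝔔) (x i)) ∧
        ∃ φ : Multiplicative ↥(AddSubmonoid.nonneg (Fin n → ℤ) ⊓
            AddMonoidHom.mker (Fintype.linearCombination ℤ
              (fun i => (a i : A ⧸ B))).toAddMonoidHom) →* 𝒮' 0,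
          (∀ p, ((φ (Multiplicative.ofAdd p) : 𝒮' 0) : S) = ∏ i, x i ^ ((p : Fin n → ℤ) i).toNat) ∧
          ∃ g' : 𝒮' 0, (g' : S) ∉ 𝔔 ∧ ∀ (𝔮 : Ideal (𝒮' 0)) [𝔮.IsPrime], g' ∉ 𝔮 →
            LogChart.IsLogRegularAt _ φ 𝔮 := by
  classical
  -- the coarsened grading, for which `𝔔` is fixed
  obtain ⟨𝒮', inst', h𝒮', hle, hfix', hA'⟩ := Coarsening.exists_coarsening_fixed 𝒮 hA 𝔔 B hB
  have hBfix : ∀ a : A, a ∉ B → ∀ s ∈ 𝒮 a, s ∈ 𝔔 := by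
    intro a haB s hs
    by_contra hsQ
    exact haB ((hB a).mpr ⟨s, hs, hsQ⟩)
  -- an adapted regular system of parameters, split by type
  obtain ⟨t, htad, htspan, htcard⟩ :=
    StabilizerAdaptedGenerators.exists_adapted_regularParameters 𝒮 𝔔 B hBfix
  set t₁ : Finset S := t.filter (fun y => ∃ a : A, a ∉ B ∧ y ∈ 𝒮 a) with ht₁
  set t₀ : Finset S := t.filter (fun y => ¬ ∃ a : A, a ∉ B ∧ y ∈ 𝒮 a) with ht₀
  have ht₀T : ∀ y ∈ t₀, y ∈ 𝒮' 0 := by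
    intro y hy
    obtain ⟨hyt, hyn⟩ := Finset.mem_filter.mp hy
    rcases (htad y hyt).2 with h | h
    · exact (hyn h).elim
    · exact mem_gradeZero_of_forall_decompose_eq_zero 𝒮 B 𝒮' hle h
  set n := t₁.card with hn
  let x : Fin n → S := fun i => (t₁.equivFin.symm i : S)
  have hxt₁ : ∀ i, x i ∈ t₁ := fun i => (t₁.equivFin.symm i).2
  choose a haB hxa using fun i : Fin n => (Finset.mem_filter.mp (hxt₁ i)).2
  have hx𝔔 : ∀ i, x i ∈ 𝔔 := fun i => (htad _ (Finset.mem_filter.mp (hxt₁ i)).1).1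
  have hx' : ∀ i, x i ∈ 𝒮' (a i : A ⧸ B) := fun i => hle (a i) (hxa i)
  have hrange : (↑t₁ : Set S) = Set.range x := by
    ext s
    constructor
    · intro hs
      exact ⟨t₁.equivFin ⟨s, hs⟩, by simp [x]⟩
    · rintro ⟨i, rfl⟩
      exact hxt₁ i
  -- the complementary parameters
  let y : Fin t₀.card → S := fun j => (t₀.equivFin.symm j : S)
  have hrange₀ : (↑t₀ : Set S) = Set.range y := by
    ext s
    constructor
    · intro hs
      exact ⟨t₀.equivFin ⟨s, hs⟩, by simp [y]⟩
    · rintro ⟨j, rfl⟩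
      exact (t₀.equivFin.symm j).2
  have htunion : (↑t : Set S) = Set.range x ∪ Set.range y := by
    rw [← hrange, ← hrange₀, ← Finset.coe_union, ht₁, ht₀, Finset.filter_union_filter_not_eq]
  have htcard' : t.card = n + t₀.card := by
    rw [hn, ht₁, ht₀]
    exact (Finset.card_filter_add_card_filter_not (s := t) _).symm
  -- `x` is part of a regular system of parameters
  haveI : IsRegularLocalRing (Localization.AtPrime 𝔔) :=
    IsRegularRing.isRegularLocalRing_localization 𝔔
  have hrsop : IsRsopPart fun i => algebraMap S (Localization.AtPrime 𝔔) (x i) := by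
    refine ⟨inferInstance, t₀.card, fun j => algebraMap S (Localization.AtPrime 𝔔) (y j), ?_, ?_⟩
    · rw [← htcard, htcard']
    · rw [show (fun i => algebraMap S (Localization.AtPrime 𝔔) (x i)) =
          ⇑(algebraMap S (Localization.AtPrime 𝔔)) ∘ x from rfl,
        show (fun j => algebraMap S (Localization.AtPrime 𝔔) (y j)) =
          ⇑(algebraMap S (Localization.AtPrime 𝔔)) ∘ y from rfl,
        Set.range_comp, Set.range_comp, ← Set.image_union, ← htunion, htspan]
  -- the chart (values in `T = S'_0`)
  set P : AddSubmonoid (Fin n → ℤ) := AddSubmonoid.nonneg (Fin n → ℤ) ⊓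
    AddMonoidHom.mker (Fintype.linearCombination ℤ (fun i => (a i : A ⧸ B))).toAddMonoidHom with hP
  have hPnonneg : ∀ p : P, (0 : Fin n → ℤ) ≤ (p : Fin n → ℤ) := fun p =>
    (AddSubmonoid.mem_nonneg.mp (AddSubmonoid.mem_inf.mp p.2).1)
  have hPdeg : ∀ p : P, Fintype.linearCombination ℤ (fun i => (a i : A ⧸ B)) (p : Fin n → ℤ) = 0 :=
    fun p => (AddMonoidHom.mem_mker).mp (AddSubmonoid.mem_inf.mp p.2).2
  have hmem : ∀ p : P, ∏ i, x i ^ ((p : Fin n → ℤ) i).toNat ∈ 𝒮' 0 := fun p => by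
    have h := FixedPointLogRegular.prod_pow_toNat_mem 𝒮' x (fun i => (a i : A ⧸ B)) hx'
      (p : Fin n → ℤ) (hPnonneg p)
    rwa [hPdeg p] at h
  let φ : Multiplicative P →* 𝒮' 0 :=
    { toFun := fun p => ⟨∏ i, x i ^ ((p.toAdd : Fin n → ℤ) i).toNat, hmem p.toAdd⟩
      map_one' := Subtype.ext (by simp)
      map_mul' := fun p q => Subtype.ext (by
        change ∏ i, x i ^ (((p.toAdd : Fin n → ℤ) + (q.toAdd : Fin n → ℤ)) i).toNat =
          (∏ i, x i ^ ((p.toAdd : Fin n → ℤ) i).toNat) * ∏ i, x i ^ ((q.toAdd : Fin n → ℤ) i).toNat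
        rw [← Finset.prod_mul_distrib]
        refine Finset.prod_congr rfl fun i _ => ?_
        rw [← pow_add, Pi.add_apply, Int.toNat_add (hPnonneg p.toAdd i) (hPnonneg q.toAdd i)]) }
  have hφ : ∀ p : P, ((φ (Multiplicative.ofAdd p) : 𝒮' 0) : S) =
      ∏ i, x i ^ ((p : Fin n → ℤ) i).toNat := fun p => rfl
  -- monomial generation over `T` by the sub-family `x`
  obtain ⟨g, hg, hgen⟩ :=
    FixedPointMonomialNhd.exists_gradeZero_forall_mul_mem_adjoin_of_fixed 𝒮' hA' 𝔔 hfix' t htspan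
  have hadj : Algebra.adjoin (𝒮' 0) (↑t : Set S) ≤ Algebra.adjoin (𝒮' 0) (Set.range x) := by
    refine Algebra.adjoin_le fun s hs => ?_
    by_cases h1 : ∃ a' : A, a' ∉ B ∧ s ∈ 𝒮 a'
    · have hs1 : s ∈ (↑t₁ : Set S) := Finset.mem_filter.mpr ⟨hs, h1⟩
      rw [hrange] at hs1
      exact Algebra.subset_adjoin hs1
    · have hs0 : s ∈ t₀ := Finset.mem_filter.mpr ⟨hs, h1⟩
      exact Subalgebra.algebraMap_mem _ (⟨s, ht₀T s hs0⟩ : 𝒮' 0)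
  have hgen' : ∀ s : S, (g : S) * s ∈ Algebra.adjoin (𝒮' 0) (Set.range x) := fun s => hadj (hgen s)
  -- the neighbourhood theorem for the family
  obtain ⟨g', hg', hreg⟩ := FamilyLogRegularNhd.exists_nhd_isLogRegularAt_of_family 𝒮' x
    (fun i => (a i : A ⧸ B)) hx' hA' 𝔔 hfix' hrsop g hg hgen' φ hφ
  exact ⟨𝒮', inst', h𝒮', hle, hfix', n, x, a, fun i => ⟨hx𝔔 i, hxa i, haB i⟩, hrsop, φ, hφ, g', hg',
    fun 𝔮 _ h𝔮 => hreg 𝔮 h𝔮⟩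

end Summit.ResolutionOfSingularities.ResolutionOfSingularities.Theorems.FRationalResolution.CoarseChartLogRegularNhd

end
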